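import Summits.AnomalousDissipation.AnomalousDissipation.Theses.SolenoidalFractalHomogenisation
import Summits.AnomalousDissipation.AnomalousDissipation.Theorems.IsotropicCubatureWord
import Summits.AnomalousDissipation.AnomalousDissipation.Theorems.SolenoidalFractalHomogenisationRealisedQuasiStaticCellLawUpperSome
import Summits.AnomalousDissipation.AnomalousDissipation.Theorems.SolenoidalFractalHomogenisationRealisedQuasiStaticCellLawSingleMode
import HarnessLib

/-!
# Negative lemma for K2 `QuasiStaticSolenoidalCellTensorQ` (stmt-AnomalousDissipation-19072): the NOMINAL quasi-static
cell law fails at the route's own isotropic design word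

Route `SolenoidalFractalHomogenisation`, item K2 (`Theses.SolenoidalFractalHomogenisation.QuasiStaticSolenoidalCellTensorQ`,
rank 3, aside) asks for SOME lattice word `W`, isotropic with an exact Taylor constant `c₀` (`IsotropicWordGain W c₀`),
whose quasi-static replay realises EVERY gain `c < c₀` (`WordGainAtRate W c ν₀ K 1`) — with `c₀` the NOMINAL
(steady-layer, full-amplitude) constant.  The cell's own finding F12 (`slotGain` docstring in
`Literature/Analysis/FluidPDE/LatticeShearWords.lean`; Armstrong–Vicol's `∫ζ² = 9/10` factor) is that a ramped word
realises only `c_W = (1 - 4·ramp/3)·c₀ < c₀`; the repaired item K2R `RealisedQuasiStaticCellLaw`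
(stmt-AnomalousDissipation-20446) is PROVED in the tree (`…Theorems.SolenoidalFractalHomogenisationRealisedQuasiStaticCellLaw`)
for the 26-slot cubature word `cubatureWord` (ramp `1/2`, `c₀ = 7/(4960π⁴)`, `c_W = c₀/3`), two-sidedly.

This file turns the UPPER side of K2R (`upperSome`: a weak A0 solution from the gravest single-mode datum keeping
`‖w(t)‖² ≥ (ν/K)·exp(−8π²(1 + (1+δ)c_W/ν²)(ν/n²)t)·‖w₀‖²`) against the nominal law: at `δ = 1/2` the floor rate uses
`(3/2)·c_W = c₀/2`, while the nominal law at `c = 3c₀/4 < c₀` would force the ceiling rate `1 + 3c₀/(4ν²)`; ceiling and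
floor cross at a finite time, and the horizon `T` is free.  Hence:

* `not_nominalGain_stretch_cubatureWord` — for every sufficiently pre-stretched copy `cubatureWord.stretch M` of the
  design word (each of which IS isotropic with the SAME nominal constant `c₀`, `isotropicWordGain_stretch`), the nominal
  law `∀ c < c₀, ∃ ν₀ K, WordGainAtRate (cubatureWord.stretch M) c ν₀ K 1` is FALSE;
* `exists_isotropic_not_nominalGain` — so there is an isotropic word with exact constant `c₀ > 0` violating K2's second
  conjunct: K2's `∃ W` cannot be witnessed inside the route's own design family, and
* `not_forall_isotropic_nominalGain` — the universally quantified nominal cell law (the natural strengthening "every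
  isotropic word realises every gain below its Taylor value") is refuted outright.

Classification: NEGATIVE LEMMA (supports the planner's supersession K2 → K2R; it is NOT `¬ QuasiStaticSolenoidalCellTensorQ`,
whose `∃ W` would need the two-sided realised law for EVERY word).  Repaired statement: K2R `RealisedQuasiStaticCellLaw`
(realised constant `(1 - 4·W.ramp/3)·c₀`, pre-stretch `M`, precision `δ`) — proved.  No new definitions; standard axioms.
-/

set_option linter.dupNamespace false

noncomputable section

namespace Summit.AnomalousDissipation.AnomalousDissipation.Theorems.QuasiStaticSolenoidalCellTensorQ.Negative

open Set MeasureTheory Filter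
open scoped InnerProductSpace
open Literature.Analysis Literature.Analysis.FunctionSpaces Literature.Analysis.FunctionSpaces.Torus
open Literature.Analysis.FluidPDE Literature.Analysis.FluidPDE.LatticeShear
open Summit.AnomalousDissipation.AnomalousDissipation.Theorems.SolenoidalFractalHomogenisation.RealisedQuasiStaticCellLaw

/-- `IsotropicWordGain` is stretch-invariant with the SAME (nominal) constant: stretching every slot by `M` multiplies
both `Σ slotGain` and `period` by `M`. -/
theorem isotropicWordGain_stretch {k : ℕ} (W : LatticeWord k) {c₀ : ℝ} (h : IsotropicWordGain W c₀) (M : ℝ)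
    (hM : 0 < M) : IsotropicWordGain (W.stretch M hM) c₀ := by
  intro q p hq hp hpq
  have h1 := h q p hq hp hpq
  have hper : (W.stretch M hM).period = M * W.period := by
    simp only [LatticeWord.period, LatticeWord.stretch, Finset.mul_sum]
  have hslot : ∀ j, slotGain ((W.stretch M hM).phase j) q p = M * slotGain (W.phase j) q p := by
    intro j
    simp only [slotGain, LatticeWord.stretch]
    ring
  simp only [hslot, ← Finset.mul_sum, h1, hper]
  ring

/-- The energy of the single-mode datum: `∫‖Re(e_ℓ) p‖² = ‖p‖²/2` for `ℓ ≠ 0`. -/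
theorem integral_norm_sq_singleMode_eq {ℓ : Fin 3 → ℤ} (hℓ : ℓ ≠ 0) (p : EuclideanSpace ℝ (Fin 3)) :
    ∫ x, ‖(UnitAddTorus.mFourier ℓ x).re • p‖ ^ 2 = ‖p‖ ^ 2 / 2 := by
  have hpt : ∀ x : UnitAddTorus (Fin 3), (UnitAddTorus.mFourier ℓ x).re • p =
      realTrigPoly {ℓ} (fun _ => EuclideanSpace.complexify p) x :=
    fun x => congrFun (singleMode_eq_realTrigPoly ℓ p) x
  have hint : Integrable (realTrigPoly {ℓ} (fun _ => EuclideanSpace.complexify p)) volume :=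
    memLp_one_iff_integrable.mp (memLp_realTrigPoly {ℓ} _ 1)
  have h1 : ∀ x : UnitAddTorus (Fin 3), ‖(UnitAddTorus.mFourier ℓ x).re • p‖ ^ 2 =
      ⟪realTrigPoly {ℓ} (fun _ => EuclideanSpace.complexify p) x,
        realTrigPoly {ℓ} (fun _ => EuclideanSpace.complexify p) x⟫_ℝ := by
    intro x; rw [hpt, real_inner_self_eq_norm_sq]
  have hne : ℓ ≠ -ℓ := by
    intro h
    apply hℓ
    funext i
    have hi := congrFun h i
    simp only [Pi.neg_apply] at hi
    simp only [Pi.zero_apply]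
    omega
  simp_rw [h1]
  rw [integral_inner_realTrigPoly_singleton hint ℓ _, mFourierCoeff_realTrigPoly_singleton, if_pos rfl, if_neg hne]
  simp only [EuclideanSpace.conjVec_zero, add_zero, inner_smul_left, inner_self_eq_norm_sq_to_K,
    EuclideanSpace.norm_complexify, map_inv₀, map_ofNat]
  -- the cast in the goal is `RCLike.ofReal`; it is definitionally `Complex.ofReal`
  have key : ∀ z : ℂ, z = ((‖p‖ : ℝ) : ℂ) → ((2:ℂ)⁻¹ * z ^ 2).re = ‖p‖ ^ 2 / 2 := by
    rintro z rfl
    rw [show (2:ℂ)⁻¹ * ((‖p‖ : ℝ) : ℂ) ^ 2 = ((‖p‖ ^ 2 / 2 : ℝ) : ℂ) by push_cast; ring, Complex.ofReal_re]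
  exact key _ rfl

/-- Crossing of an exponential floor and an exponential ceiling: `A e^{-at} E ≤ B e^{-bt} E` with `A, B, E > 0` and
`a < b` forces `t ≤ log (B/A) / (b - a)` (for `B ≤ 0` the right side is read with `log`'s junk value, still true). -/
theorem le_crossing_time {A B E a b t : ℝ} (hA : 0 < A) (hE : 0 < E) (hab : a < b)
    (h : A * Real.exp (-a * t) * E ≤ B * Real.exp (-b * t) * E) : t ≤ Real.log (B / A) / (b - a) := by
  have h0 : A * Real.exp (-a * t) ≤ B * Real.exp (-b * t) := le_of_mul_le_mul_right h hE
  have h1 : Real.exp ((b - a) * t) ≤ B / A := by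
    rw [le_div_iff₀ hA]
    have h2 := mul_le_mul_of_nonneg_right h0 (Real.exp_pos (b * t)).le
    calc Real.exp ((b - a) * t) * A = A * Real.exp (-a * t) * Real.exp (b * t) := by
          rw [mul_assoc, ← Real.exp_add, mul_comm]; ring_nf
      _ ≤ B * Real.exp (-b * t) * Real.exp (b * t) := h2
      _ = B := by rw [mul_assoc, ← Real.exp_add]; simp
  rw [le_div_iff₀ (sub_pos.mpr hab)]
  calc t * (b - a) = Real.log (Real.exp ((b - a) * t)) := by rw [Real.log_exp, mul_comm]
    _ ≤ Real.log (B / A) := Real.log_le_log (Real.exp_pos _) h1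

/-- The ramp fraction of the cubature word is `1/2` (so its realised constant is `c₀/3`). -/
theorem ramp_cubatureWord : cubatureWord.ramp = 1 / 2 := rfl

/-- **The nominal quasi-static cell law fails at every sufficiently pre-stretched copy of the design word.**
For `M ≥ M₀` (K2R's upper-side pre-stretch), `∀ c < c₀, ∃ ν₀ K, WordGainAtRate (cubatureWord.stretch M) c ν₀ K 1` is
false: at `c = 3c₀/4` its ceiling `(K/ν)·exp(−8π²(1 + 3c₀/(4ν²))(ν/n²)t)·‖w₀‖²` on the energy of the gravest single-mode
solution undercuts K2R's floor `(ν/K')·exp(−8π²(1 + c₀/(2ν²))(ν/n²)t)·‖w₀‖²` (`upperSome` at `δ = 1/2`) after the finite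
crossing time, while the horizon `T` is arbitrary. -/
theorem not_nominalGain_stretch_cubatureWord :
    ∃ M₀ > (0:ℝ), ∀ M : ℝ, ∀ hM : 0 < M, M₀ ≤ M →
      ¬ (∀ c, 0 < c → c < c0 → ∃ ν₀ > (0:ℝ), ∃ K > (0:ℝ), WordGainAtRate (cubatureWord.stretch M hM) c ν₀ K 1) := by
  obtain ⟨M₀, hM₀, HU⟩ := upperSome (1 / 2) (by norm_num)
  refine ⟨M₀, hM₀, fun M hM hMM H => ?_⟩
  obtain ⟨ν₁, hν₁, K₁, hK₁, U⟩ := HU M hM hMM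
  have hc0 : 0 < c0 := c0_pos
  obtain ⟨ν₂, hν₂, K₂, hK₂, G⟩ := H (3 * c0 / 4) (by positivity) (by linarith)
  -- a common cell viscosity inside both regimes
  obtain ⟨ν, hν0, hνlt₁, hνlt₂⟩ : ∃ ν : ℝ, 0 < ν ∧ ν < ν₁ ∧ ν < ν₂ :=
    ⟨min ν₁ ν₂ / 2, by positivity, (half_lt_self (lt_min hν₁ hν₂)).trans_le (min_le_left _ _),
      (half_lt_self (lt_min hν₁ hν₂)).trans_le (min_le_right _ _)⟩
  have G1 := G ν ⟨hν0, hνlt₂⟩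
  rw [Real.rpow_one] at G1
  -- the gravest mode `ℓ = e₀` with polarisation `p = e₁`
  have hℓ : (Pi.single 0 1 : Fin 3 → ℤ) ≠ 0 := by
    intro h
    have h0 := congrFun h 0
    simp at h0
  have hℓnorm : ‖latticeVec (Pi.single 0 1 : Fin 3 → ℤ)‖ = 1 := by
    rw [latticeVec_single]; simp
  have hp : ‖(EuclideanSpace.single 1 (1:ℝ) : EuclideanSpace ℝ (Fin 3))‖ = 1 := by simp
  have hpl : ⟪(EuclideanSpace.single 1 (1:ℝ) : EuclideanSpace ℝ (Fin 3)), latticeVec (Pi.single 0 1 : Fin 3 → ℤ)⟫_ℝ = 0 := by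
    rw [latticeVec_single, EuclideanSpace.inner_single_left]
    simp
  -- enough cells for both thresholds
  set n : ℕ := ⌈K₂ / ν⌉₊ + ⌈K₁ / ν⌉₊ with hndef
  have hnG : ⌈K₂ / ν⌉₊ ≤ n := Nat.le_add_right _ _
  have hK₁c : (0:ℝ) < (⌈K₁ / ν⌉₊ : ℕ) := by exact_mod_cast Nat.ceil_pos.mpr (div_pos hK₁ hν0)
  have hK₂c : (0:ℝ) ≤ (⌈K₂ / ν⌉₊ : ℕ) := Nat.cast_nonneg _
  have hncast : (n : ℝ) = (⌈K₂ / ν⌉₊ : ℕ) + (⌈K₁ / ν⌉₊ : ℕ) := by rw [hndef]; push_cast; ring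
  have hnU : ‖latticeVec (Pi.single 0 1 : Fin 3 → ℤ)‖ * (⌈K₁ / ν⌉₊ : ℝ) ≤ n := by
    rw [hℓnorm, one_mul, hncast]; linarith
  have hn0 : (0:ℝ) < n := by rw [hncast]; linarith
  -- the two bounds, specialised to this mode, and the crossing time
  have U1 := U ν ⟨hν0, hνlt₁⟩ n (Pi.single 0 1) hℓ hnU (EuclideanSpace.single 1 (1:ℝ)) hp hpl
  set a : ℝ := 8 * Real.pi ^ 2 * ‖latticeVec (Pi.single 0 1 : Fin 3 → ℤ)‖ ^ 2 *
      (1 + (1 + 1 / 2) * ((1 - 4 * cubatureWord.ramp / 3) * c0) / ν ^ 2) * ν / (n:ℝ) ^ 2 with hadef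
  set b : ℝ := 8 * Real.pi ^ 2 * (1 + 3 * c0 / 4 / ν ^ 2) * ν / (n:ℝ) ^ 2 with hbdef
  have hab : a < b := by
    have key : b - a = 2 * Real.pi ^ 2 * c0 / (ν * (n:ℝ) ^ 2) := by
      rw [hadef, hbdef, hℓnorm, ramp_cubatureWord]
      field_simp
      ring
    have hpos : 0 < 2 * Real.pi ^ 2 * c0 / (ν * (n:ℝ) ^ 2) := by positivity
    linarith
  set t₀ : ℝ := Real.log ((K₂ / ν) / (ν / K₁)) / (b - a) with ht₀def
  set T : ℝ := |t₀| + 2 with hTdef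
  have hT : 0 < T := by positivity
  obtain ⟨w, hw, hlow⟩ := U1 T hT
  have hup := G1 n hnG (fun x => (UnitAddTorus.mFourier (Pi.single 0 1 : Fin 3 → ℤ) x).re • (EuclideanSpace.single 1 (1:ℝ) : EuclideanSpace ℝ (Fin 3)))
    (memSobolev_one_singleMode _ _) (isWeaklyDivFree_singleMode _ hpl) (hasZeroMean_singleMode hℓ _) T hT w hw
  -- both bounds hold at some late time `t ∈ (|t₀| + 1, T)`
  have hsub : Ioo (|t₀| + 1) T ⊆ Ioo 0 T := Ioo_subset_Ioo_left (by positivity)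
  have hmem : ∀ᵐ t ∂(volume.restrict (Ioo (|t₀| + 1) T)), t ∈ Ioo (|t₀| + 1) T := ae_restrict_mem measurableSet_Ioo
  haveI : (ae (volume.restrict (Ioo (|t₀| + 1) T))).NeBot := by
    rw [ae_neBot, Ne, Measure.restrict_eq_zero, Real.volume_Ioo, ENNReal.ofReal_eq_zero, not_le, hTdef]
    linarith
  obtain ⟨t, ht, h1, h2⟩ := (hmem.and ((ae_restrict_of_ae_restrict_of_subset hsub hlow).and
    (ae_restrict_of_ae_restrict_of_subset hsub hup))).exists
  have hE0 : 0 < ∫ x, ‖(UnitAddTorus.mFourier (Pi.single 0 1 : Fin 3 → ℤ) x).re • (EuclideanSpace.single 1 (1:ℝ) : EuclideanSpace ℝ (Fin 3))‖ ^ 2 := by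
    rw [integral_norm_sq_singleMode_eq hℓ, hp]; norm_num
  have hcross : t ≤ t₀ :=
    le_crossing_time (div_pos hν0 hK₁) hE0 hab (h1.trans h2)
  have habs : t₀ ≤ |t₀| := le_abs_self t₀
  linarith [ht.1]

/-- **An isotropic word with exact constant `c₀ > 0` violating K2's nominal law** (the `∃ W` of
`QuasiStaticSolenoidalCellTensorQ` cannot be witnessed in the route's own design family `cubatureWord.stretch M`). -/
theorem exists_isotropic_not_nominalGain :
    ∃ k, ∃ W : LatticeWord k, ∃ c₀ > (0:ℝ), IsotropicWordGain W c₀ ∧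
      ¬ (∀ c, 0 < c → c < c₀ → ∃ ν₀ > (0:ℝ), ∃ K > (0:ℝ), WordGainAtRate W c ν₀ K 1) := by
  obtain ⟨M₀, hM₀, h⟩ := not_nominalGain_stretch_cubatureWord
  exact ⟨26, cubatureWord.stretch M₀ hM₀, c0, c0_pos, isotropicWordGain_stretch _ isotropicWordGain_cubatureWord _ hM₀,
    h M₀ hM₀ le_rfl⟩

/-- **The universally quantified nominal cell law is false**: it is NOT the case that every isotropic lattice word
realises every gain below its (nominal) Taylor constant — the natural `∀`-strengthening of K2's second conjunct, and
the premise shape of the superseded K1 `ProjectedRenormalisationStep` read as a law, refuted. -/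
theorem not_forall_isotropic_nominalGain :
    ¬ (∀ k (W : LatticeWord k) (c₀ : ℝ), 0 < c₀ → IsotropicWordGain W c₀ →
        ∀ c, 0 < c → c < c₀ → ∃ ν₀ > (0:ℝ), ∃ K > (0:ℝ), WordGainAtRate W c ν₀ K 1) := by
  intro h
  obtain ⟨k, W, c₀, hc₀, hiso, hnot⟩ := exists_isotropic_not_nominalGain
  exact hnot (h k W c₀ hc₀ hiso)

end Summit.AnomalousDissipation.AnomalousDissipation.Theorems.QuasiStaticSolenoidalCellTensorQ.Negative

end
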